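import Literature.Barriers.CriticalPhenomena.WeaklySAWProgressiveIntegration
import HarnessLib

/-!
# `E_Cθ` preserves forms with continuous coefficients of polynomial growth

Companion to `WeaklySAWProgressiveIntegration.lean` (BBS 2015, Proposition 5.1). The hypotheses of
`convTheta_convTheta` — every coefficient of `F` continuous with `‖f(φ)‖ ≤ K(1+‖φ‖)^k` — are
preserved by the Gaussian super-convolution `E_Cθ = convTheta A` for real symmetric positive-definite
`A`, so that Proposition 5.1 can be applied repeatedly and in any bracketing (BBS 2015, §5.1,
(5.2)–(5.3): `Z_{j+1} = E_{C_{j+1}}θ Z_j`):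

* `continuous_gaussConvolution`, `norm_gaussConvolution_le`: `μ_C * f` is continuous and of the same
  polynomial growth (dominated convergence against `(1+‖ξ‖)^k e^{-c‖ξ‖²}`);
* `repr_convTheta`: the coefficients of `E_Cθ F` (from `convTheta_eq_sum`);
* **`continuous_repr_convTheta`**, **`exists_bound_repr_convTheta`**: `E_Cθ F` again has continuous
  coefficients of polynomial growth.

Everything is proved; no named facts.
-/

noncomputable section

open MeasureTheory Complex ComplexConjugate Filter Topology
open Literature.MathematicalPhysics.QuantumLattice
open Literature.MathematicalPhysics.QuantumLattice.GrassmannAlgebra (grassmannBasis)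
open scoped BigOperators

namespace Literature.Barriers.CriticalPhenomena

namespace CTWSAW

section Regularity

variable {Λ : Type*} [LinearOrder Λ] [Fintype Λ]

variable {A : Matrix Λ Λ ℂ} {c : ℝ}

omit [LinearOrder Λ] in
/-- The constant in a polynomial growth bound is non-negative. [folklore] -/
theorem nonneg_of_growth_bound {f : FieldFun Λ} {K : ℝ} {k : ℕ} (hfb : ∀ x, ‖f x‖ ≤ K * (1 + ‖x‖) ^ k) : 0 ≤ K := by
  have := hfb 0
  have h0 : (0 : ℝ) ≤ ‖f 0‖ := norm_nonneg _
  simp at this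
  linarith

omit [LinearOrder Λ] in
/-- The shifted growth bound: `‖f(φ+ξ)‖ ≤ K(1+‖φ‖)^k(1+‖ξ‖)^k`. [folklore] -/
theorem norm_shift_le {f : FieldFun Λ} {K : ℝ} {k : ℕ} (hfb : ∀ x, ‖f x‖ ≤ K * (1 + ‖x‖) ^ k) (φ ξ : Λ → ℂ) :
    ‖f (φ + ξ)‖ ≤ K * (1 + ‖φ‖) ^ k * (1 + ‖ξ‖) ^ k := by
  have hK := nonneg_of_growth_bound hfb
  calc ‖f (φ + ξ)‖ ≤ K * (1 + ‖φ + ξ‖) ^ k := hfb _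
    _ ≤ K * ((1 + ‖φ‖) * (1 + ‖ξ‖)) ^ k := by
        refine mul_le_mul_of_nonneg_left (pow_le_pow_left₀ (by positivity) ?_ k) hK
        nlinarith [norm_add_le φ ξ, norm_nonneg φ, norm_nonneg ξ, mul_nonneg (norm_nonneg φ) (norm_nonneg ξ)]
    _ = K * (1 + ‖φ‖) ^ k * (1 + ‖ξ‖) ^ k := by rw [mul_pow]; ring

/-- **`μ_C * f` is continuous** for `f` continuous of polynomial growth (`C⁻¹ = A` real symmetric
positive-definite): dominated convergence, locally uniformly in `φ`, against `(1+‖ξ‖)^k e^{-c‖ξ‖²}`.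
[folklore] -/
theorem continuous_gaussConvolution (h : RealPosDef A c) {f : FieldFun Λ} (hf : Continuous f) {K : ℝ} {k : ℕ}
    (hfb : ∀ x, ‖f x‖ ≤ K * (1 + ‖x‖) ^ k) : Continuous (gaussConvolution A f) := by
  have hK := nonneg_of_growth_bound hfb
  have hint : Continuous fun φ : Λ → ℂ => ∫ ξ : Λ → ℂ, f (φ + ξ) * Boson.gaussWeight A ξ := by
    have hgw : Continuous (Boson.gaussWeight A) := by unfold Boson.gaussWeight Boson.quadForm; fun_prop
    refine continuous_iff_continuousAt.2 fun φ₀ => ?_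
    refine continuousAt_of_dominated (bound := fun ξ => K * (2 + ‖φ₀‖) ^ k * ((1 + ‖ξ‖) ^ k * Real.exp (-(c * ‖ξ‖ ^ 2))))
      (Eventually.of_forall fun φ => ((hf.comp (continuous_const.add continuous_id)).mul hgw).aestronglyMeasurable)
      ?_ (((Boson.integrable_one_add_norm_pow_mul_exp_neg h.pos k).const_mul (K * (2 + ‖φ₀‖) ^ k)))
      (Eventually.of_forall fun ξ => ((hf.comp (continuous_id.add continuous_const)).mul continuous_const).continuousAt)
    filter_upwards [Metric.ball_mem_nhds φ₀ one_pos] with φ hφ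
    refine Eventually.of_forall fun ξ => ?_
    have hφ' : ‖φ‖ ≤ 1 + ‖φ₀‖ := by
      have := norm_le_norm_add_norm_sub' φ φ₀
      have hd : ‖φ - φ₀‖ < 1 := by rwa [← dist_eq_norm]
      linarith
    rw [norm_mul]
    calc ‖f (φ + ξ)‖ * ‖Boson.gaussWeight A ξ‖
        ≤ K * (1 + ‖φ‖) ^ k * (1 + ‖ξ‖) ^ k * Real.exp (-(c * ‖ξ‖ ^ 2)) :=
          mul_le_mul (norm_shift_le hfb φ ξ) (Boson.norm_gaussWeight_le h.pos.le h.bound ξ) (norm_nonneg _)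
            (by positivity)
      _ ≤ K * (2 + ‖φ₀‖) ^ k * (1 + ‖ξ‖) ^ k * Real.exp (-(c * ‖ξ‖ ^ 2)) := by
          have hpow : (1 + ‖φ‖) ^ k ≤ (2 + ‖φ₀‖) ^ k := pow_le_pow_left₀ (by positivity) (by linarith) k
          exact mul_le_mul_of_nonneg_right (mul_le_mul_of_nonneg_right (mul_le_mul_of_nonneg_left hpow hK)
            (by positivity)) (by positivity)
      _ = K * (2 + ‖φ₀‖) ^ k * ((1 + ‖ξ‖) ^ k * Real.exp (-(c * ‖ξ‖ ^ 2))) := by ring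
  unfold gaussConvolution
  exact continuous_const.mul hint

/-- **`μ_C * f` has the polynomial growth of `f`**: `‖(μ_C*f)(φ)‖ ≤ K' (1+‖φ‖)^k` with
`K' = |det A/π^{|Λ|}| K ∫(1+‖ξ‖)^k e^{-c‖ξ‖²}dξ`. [folklore] -/
theorem norm_gaussConvolution_le (h : RealPosDef A c) {f : FieldFun Λ} {K : ℝ} {k : ℕ}
    (hfb : ∀ x, ‖f x‖ ≤ K * (1 + ‖x‖) ^ k) (φ : Λ → ℂ) :
    ‖gaussConvolution A f φ‖ ≤ ‖A.det / (Real.pi : ℂ) ^ Fintype.card Λ‖ * K *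
      (∫ ξ : Λ → ℂ, (1 + ‖ξ‖) ^ k * Real.exp (-(c * ‖ξ‖ ^ 2))) * (1 + ‖φ‖) ^ k := by
  have hK := nonneg_of_growth_bound hfb
  have hI := Boson.integrable_one_add_norm_pow_mul_exp_neg (Λ := Λ) h.pos k
  have hbound : ‖∫ ξ : Λ → ℂ, f (φ + ξ) * Boson.gaussWeight A ξ‖ ≤
      ∫ ξ : Λ → ℂ, K * (1 + ‖φ‖) ^ k * ((1 + ‖ξ‖) ^ k * Real.exp (-(c * ‖ξ‖ ^ 2))) := by
    refine norm_integral_le_of_norm_le (hI.const_mul _) (Eventually.of_forall fun ξ => ?_)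
    rw [norm_mul]
    calc ‖f (φ + ξ)‖ * ‖Boson.gaussWeight A ξ‖
        ≤ K * (1 + ‖φ‖) ^ k * (1 + ‖ξ‖) ^ k * Real.exp (-(c * ‖ξ‖ ^ 2)) :=
          mul_le_mul (norm_shift_le hfb φ ξ) (Boson.norm_gaussWeight_le h.pos.le h.bound ξ) (norm_nonneg _)
            (by positivity)
      _ = K * (1 + ‖φ‖) ^ k * ((1 + ‖ξ‖) ^ k * Real.exp (-(c * ‖ξ‖ ^ 2))) := by ring
  rw [integral_const_mul] at hbound
  unfold gaussConvolution
  rw [norm_mul]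
  calc ‖A.det / (Real.pi : ℂ) ^ Fintype.card Λ‖ * ‖∫ ξ : Λ → ℂ, f (φ + ξ) * Boson.gaussWeight A ξ‖
      ≤ ‖A.det / (Real.pi : ℂ) ^ Fintype.card Λ‖ *
          (K * (1 + ‖φ‖) ^ k * ∫ ξ : Λ → ℂ, (1 + ‖ξ‖) ^ k * Real.exp (-(c * ‖ξ‖ ^ 2))) :=
        mul_le_mul_of_nonneg_left hbound (norm_nonneg _)
    _ = _ := by ring

/-- **The coefficients of `E_Cθ F`** (eq. (4.22) for a general form, `convTheta_eq_sum`):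
`(E_Cθ F)_s = Σ_u ε (det A)⁻¹ fermiKernel A u s · μ_C * f_u`. [cite: BauerschmidtBrydgesSlade2015LogCorr, §4.1, eqs. (4.21)-(4.23)] -/
theorem repr_convTheta (h : RealPosDef A c) {F : SForm Λ}
    (hFc : ∀ u, Continuous ((grassmannBasis (FieldFun Λ) (Λ ⊕ₗ Λ)).repr F u))
    (hFb : ∀ u, ∃ K : ℝ, ∃ k : ℕ, ∀ x, ‖(grassmannBasis (FieldFun Λ) (Λ ⊕ₗ Λ)).repr F u x‖ ≤ K * (1 + ‖x‖) ^ k)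
    (s : Finset (Λ ⊕ₗ Λ)) :
    (grassmannBasis (FieldFun Λ) (Λ ⊕ₗ Λ)).repr (convTheta A F) s = fun φ =>
      ∑ u : Finset (Λ ⊕ₗ Λ), orientSign Λ * (A.det)⁻¹ *
        fermiKernel A (u.map (blockPsi Λ).toEmbedding) (s.map (blockPsi Λ).toEmbedding) *
          gaussConvolution A ((grassmannBasis (FieldFun Λ) (Λ ⊕ₗ Λ)).repr F u) φ := by
  have hI : ∀ (u : Finset (Λ ⊕ₗ Λ)) (φ : Λ → ℂ), Integrable fun ξ : Λ → ℂ =>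
      (grassmannBasis (FieldFun Λ) (Λ ⊕ₗ Λ)).repr F u (φ + ξ) * Boson.gaussWeight A ξ := fun u φ => by
    obtain ⟨K, k, hk⟩ := hFb u
    exact integrable_shift_mul_gaussWeight h (hFc u) hk φ
  rw [convTheta_eq_sum A h.isUnit_det.ne_zero F hI, repr_sum_smul_grassmannBasis]

/-- **`E_Cθ F` has continuous coefficients** when `F` has continuous coefficients of polynomial growth.
[folklore] -/
theorem continuous_repr_convTheta (h : RealPosDef A c) {F : SForm Λ}
    (hFc : ∀ u, Continuous ((grassmannBasis (FieldFun Λ) (Λ ⊕ₗ Λ)).repr F u))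
    (hFb : ∀ u, ∃ K : ℝ, ∃ k : ℕ, ∀ x, ‖(grassmannBasis (FieldFun Λ) (Λ ⊕ₗ Λ)).repr F u x‖ ≤ K * (1 + ‖x‖) ^ k)
    (s : Finset (Λ ⊕ₗ Λ)) :
    Continuous ((grassmannBasis (FieldFun Λ) (Λ ⊕ₗ Λ)).repr (convTheta A F) s) := by
  rw [repr_convTheta h hFc hFb s]
  refine continuous_finsetSum _ fun u _ => continuous_const.mul ?_
  obtain ⟨K, k, hk⟩ := hFb u
  exact continuous_gaussConvolution h (hFc u) hk

/-- **`E_Cθ F` has coefficients of polynomial growth** when `F` has continuous coefficients of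
polynomial growth. [folklore] -/
theorem exists_bound_repr_convTheta (h : RealPosDef A c) {F : SForm Λ}
    (hFc : ∀ u, Continuous ((grassmannBasis (FieldFun Λ) (Λ ⊕ₗ Λ)).repr F u))
    (hFb : ∀ u, ∃ K : ℝ, ∃ k : ℕ, ∀ x, ‖(grassmannBasis (FieldFun Λ) (Λ ⊕ₗ Λ)).repr F u x‖ ≤ K * (1 + ‖x‖) ^ k)
    (s : Finset (Λ ⊕ₗ Λ)) :
    ∃ K : ℝ, ∃ k : ℕ, ∀ x, ‖(grassmannBasis (FieldFun Λ) (Λ ⊕ₗ Λ)).repr (convTheta A F) s x‖ ≤ K * (1 + ‖x‖) ^ k := by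
  classical
  choose K k hk using hFb
  -- growth constants of the convolved coefficients
  set K' : Finset (Λ ⊕ₗ Λ) → ℝ := fun u => ‖A.det / (Real.pi : ℂ) ^ Fintype.card Λ‖ * K u *
    ∫ ξ : Λ → ℂ, (1 + ‖ξ‖) ^ k u * Real.exp (-(c * ‖ξ‖ ^ 2)) with hK'
  set kmax : ℕ := Finset.univ.sup k with hkmax
  refine ⟨∑ u : Finset (Λ ⊕ₗ Λ), ‖orientSign Λ * (A.det)⁻¹ *
      fermiKernel A (u.map (blockPsi Λ).toEmbedding) (s.map (blockPsi Λ).toEmbedding)‖ * K' u, kmax, fun x => ?_⟩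
  rw [repr_convTheta h hFc (fun u => ⟨K u, k u, hk u⟩) s]
  refine (norm_sum_le _ _).trans ?_
  rw [Finset.sum_mul]
  refine Finset.sum_le_sum fun u _ => ?_
  rw [norm_mul]
  have hKu : 0 ≤ K' u := by
    have h1 : 0 ≤ K u := nonneg_of_growth_bound (hk u)
    have h2 : 0 ≤ ∫ ξ : Λ → ℂ, (1 + ‖ξ‖) ^ k u * Real.exp (-(c * ‖ξ‖ ^ 2)) :=
      integral_nonneg fun ξ => by positivity
    positivity
  have hx1 : 1 ≤ 1 + ‖x‖ := by linarith [norm_nonneg x]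
  calc ‖orientSign Λ * (A.det)⁻¹ * fermiKernel A (u.map (blockPsi Λ).toEmbedding) (s.map (blockPsi Λ).toEmbedding)‖ *
        ‖gaussConvolution A ((grassmannBasis (FieldFun Λ) (Λ ⊕ₗ Λ)).repr F u) x‖
      ≤ ‖orientSign Λ * (A.det)⁻¹ * fermiKernel A (u.map (blockPsi Λ).toEmbedding) (s.map (blockPsi Λ).toEmbedding)‖ *
          (K' u * (1 + ‖x‖) ^ k u) :=
        mul_le_mul_of_nonneg_left (norm_gaussConvolution_le h (hk u) x) (norm_nonneg _)
    _ ≤ ‖orientSign Λ * (A.det)⁻¹ * fermiKernel A (u.map (blockPsi Λ).toEmbedding) (s.map (blockPsi Λ).toEmbedding)‖ *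
          (K' u * (1 + ‖x‖) ^ kmax) := by
        gcongr
        exact Finset.le_sup (Finset.mem_univ u)
    _ = _ := by ring

end Regularity

end CTWSAW

end Literature.Barriers.CriticalPhenomena
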